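import Mathlib
import HarnessLib
import Summits.HubbardSuperconductivity.HubbardSuperconductivity.Theorems.KLProgrammeKLRegimeSectorSliceAlphaFat

/-!
# Route `KLProgramme` — engine support, route (L2), FAT layer 4c: **`α_n` for the FAT sector family on an admissible frame** — the row and
# column sums `hrow`/`hcol` of `hubbardSectorKernelNorm_effAction_le_of_sectorNorm` for `C = hubbardCovSliceCT L M β μ 0 K Λ Λ′` pulled back by
# `S = sectorSubMatrix L M β Ft`, `Ft = bgmFatMultiplier L M e₀ β (nambuXiCT L μ K) (m+1)`

Cell `gate-hubbard-kl`, seat hubbard-kl-k3c2-p3; gen-4 ENGINE child stmt-HubbardSuperconductivity-19855 (`stub_engine_step_norms`).  For each sector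
`ω` the integer frame vector `v_ω = round(N_r τ̂(p_F(θ_ω)))` (`tangentStep_bounds`, `…IntegerTangentNorm`) feeds `slicePair_bgmFat_le`; the
overlap count `card_overlap_bgmFat_le_nine(')` and `rowSum_/colSum_norm_pullback_sliceCT_le_alpha` give

* **`rowSum_sliceCT_bgmFat_le`**, **`colSum_sliceCT_bgmFat_le`** — `Σ_{Y′} ‖(Sᵀ C S) Y Y′‖ ≤ 8·(9·T_max)` and the column twin, i.e.
  `α = 72·T_max` with `T_max` the uniform bound of `slicePair_bgmFat_le`, under the same frame/slice/rate hypotheses.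

Everything is proved; no definitions, no named facts. [folklore] (BGM 2006 §2.8 (2.81), Lemma 2.2.)
-/

noncomputable section

namespace Summit.HubbardSuperconductivity.HubbardSuperconductivity.Theorems.TorusFourierL2

set_option linter.dupNamespace false -- summit = problem name (single-conjunct summit), D-0017

open Set Finset Literature.MathematicalPhysics.QuantumLattice Literature.MathematicalPhysics.QuantumLattice.BandSectorCounting
open Literature.MathematicalPhysics.QuantumLattice.FermiRG Literature.Probability.LatticeModels Literature.Analysis.SpecialFunctions
open Summit.HubbardSuperconductivity.HubbardSuperconductivity.Theorems.DispersionFlow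
open Summit.HubbardSuperconductivity.HubbardSuperconductivity.Theorems.KLRegimeSplit
open Summit.HubbardSuperconductivity.HubbardSuperconductivity.Theorems.KLProgrammeLegKernels
open Summit.HubbardSuperconductivity.HubbardSuperconductivity.Theorems.PerturbedFermiCurve
open scoped Real Nat

section Rows

open Classical

variable {L M : ℕ} [NeZero L] [NeZero M] {a b : ℝ} (B : BandBounds a b) {K : TrigPolyC4v} {A : ℝ}
  (hA : ∀ p : Momentum, ∀ j ≤ 2, ‖iteratedFDeriv ℝ j (frameShift K) p‖ ≤ A) (hADt : 2 * A < B.Dtmin)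
  {μ e₀ z β : ℝ} (he : 0 < e₀) (hz : 0 < z) (hz1 : z ≤ 1) (hgap : e₀ + A + z ^ 2 < -μ) (h3 : e₀ + A - μ ≤ 3)
  (hlo : a ≤ μ - A - e₀) (hhi : μ + A + e₀ ≤ b) (hβ : 0 < β) (hρA : 4 * A < 2 * B.rhomin)
  (m : ℕ) (hMm : klScale e₀ m * β < π * (2 * M - 3))
  {d : ℝ} (hd : 0 ≤ d) (hd1 : ∀ u, |deriv (bgmCutoffSq e₀) u| ≤ d) (hd2 : ∀ u, |iteratedDeriv 2 (bgmCutoffSq e₀) u| ≤ d)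
  {Ba : ℝ} (hB0 : 0 ≤ Ba)
  (hB : ∀ (i : ℕ), i ≤ 2 → ∀ (n : ℕ) (ω : ℤ) (θ₀ : ℝ) (q w : Fin 2 → ℝ) (t : ℝ) {r₀ : ℝ}, 0 < r₀ →
    r₀ ≤ ‖momToComplex (q + t • w)‖ → |sectorRelAngle θ₀ (q + t • w)| < π →
    ‖iteratedDeriv i (fun t : ℝ => sectorWeightCirc n ω (polarAngle (q + t • w))) t‖ ≤
      (2 : ℕ)! * Ba * ((1 + (sectorWidth n)⁻¹ * (2 : ℕ)!) * ‖momToComplex w‖ / r₀) ^ i)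
  -- the slice and the Euclidean frame data of the propagator side
  {Λ Λ' : ℝ} (hΛ : 0 < Λ) (hΛΛ' : Λ ≤ Λ') (hM' : Λ' < π * (2 * M - 3) / β)
  {K₁ K₂ : ℝ} (hK₁ : ∀ p, ‖fderiv ℝ (frameLevel μ K) p‖ ≤ K₁) (hK₂ : ∀ p, ‖iteratedFDeriv ℝ 2 (frameLevel μ K) p‖ ≤ K₂)
  {B₁ B₂ : ℝ} (hB₁ : ∀ x, |deriv salmhoferCutoff x| ≤ B₁) (hB₂ : ∀ x, |deriv (deriv salmhoferCutoff) x| ≤ B₂)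
  -- tangent resolution, zone margin for the steps, far-region radius
  {Nr : ℝ} (hNr : 2 ≤ Nr) (hLz : 2 * |2 * π / L| * (Nr + 1 / 2) ≤ z) {R₀ : ℕ} (hR₀ : 2 * (2 * Nr + 1) * (R₀ : ℝ) < L)
  -- abbreviations (instantiate with `rfl`)
  {ℓ₁ ℓ ρf G₁ G₂ Kp wsi τt Ae1 Ae2 An1 An2 Av1 Av2 : ℝ}
  (hℓ₁ : ℓ₁ = 2 * π / L) (hℓ : ℓ = 2 * π / L * (Nr + 1 / 2))
  (hρf : ρf = (klScale e₀ m + B.smax * B.Dtmin * (3 * sectorWidth (m + 1) / 4)) / (B.Dtmin - 2 * A) +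
    π * Real.sqrt 2 * (1 + (4 + 2 * A) / (B.Dtmin - 2 * A)) * sectorWidth (m + 1))
  (hG₁ : G₁ = d * e₀ ^ 2 * 1 + 1 * (d * e₀ ^ 2)) (hG₂ : G₂ = d * e₀ ^ 4 * 1 + 2 * (d * e₀ ^ 2) * (d * e₀ ^ 2) + 1 * (d * e₀ ^ 4))
  (hKp : Kp = 4 + 4 * A) (hwsi : wsi = (sectorWidth (m + 1))⁻¹)
  (hτt : τt = |2 * π / L| * (4 + 2 * A) + K₂ * (Real.sqrt 2 * ρf) * (Real.sqrt 2 * ℓ))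
  (hAe1 : Ae1 = 2 * G₁ * ((4 + 2 * A) * ℓ₁ + Kp * (ρf + 2 * ℓ₁) * ℓ₁) / klScale e₀ m * 1 + 1 * 1 * (9 * (4 * Ba * ((1 + 2 * wsi) * (2 * ℓ₁)))))
  (hAe2 : Ae2 = ((4 * G₂ + 2 * G₁) * ((4 + 2 * A) * ℓ₁ + Kp * (ρf + 2 * ℓ₁) * ℓ₁) ^ 2 / klScale e₀ m ^ 2 + 2 * G₁ * (Kp * ℓ₁ ^ 2) / klScale e₀ m) * 1 +
    4 * G₁ * ((4 + 2 * A) * ℓ₁ + Kp * (ρf + 2 * ℓ₁) * ℓ₁) / klScale e₀ m * (9 * (4 * Ba * ((1 + 2 * wsi) * (2 * ℓ₁)))) +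
    1 * 1 * (9 * (4 * Ba * ((1 + 2 * wsi) * (2 * ℓ₁)) ^ 2 + 8 * Ba ^ 2 * ((1 + 2 * wsi) * (2 * ℓ₁)) ^ 2)))
  (hAn1 : An1 = 2 * G₁ * ((4 + 2 * A) * ℓ + Kp * (ρf + 2 * ℓ) * ℓ) / klScale e₀ m * 1 + 1 * 1 * (9 * (4 * Ba * ((1 + 2 * wsi) * (2 * ℓ)))))
  (hAn2 : An2 = ((4 * G₂ + 2 * G₁) * ((4 + 2 * A) * ℓ + Kp * (ρf + 2 * ℓ) * ℓ) ^ 2 / klScale e₀ m ^ 2 + 2 * G₁ * (Kp * ℓ ^ 2) / klScale e₀ m) * 1 +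
    4 * G₁ * ((4 + 2 * A) * ℓ + Kp * (ρf + 2 * ℓ) * ℓ) / klScale e₀ m * (9 * (4 * Ba * ((1 + 2 * wsi) * (2 * ℓ)))) +
    1 * 1 * (9 * (4 * Ba * ((1 + 2 * wsi) * (2 * ℓ)) ^ 2 + 8 * Ba ^ 2 * ((1 + 2 * wsi) * (2 * ℓ)) ^ 2)))
  (hAv1 : Av1 = 2 * G₁ * (|2 * π / L| * (4 + 2 * A) + Kp * (ρf + 2 * ℓ) * ℓ) / klScale e₀ m * 1 + 1 * 1 * (9 * (4 * Ba * ((1 + 2 * wsi) * (2 * ℓ)))))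
  (hAv2 : Av2 = ((4 * G₂ + 2 * G₁) * (|2 * π / L| * (4 + 2 * A) + Kp * (ρf + 2 * ℓ) * ℓ) ^ 2 / klScale e₀ m ^ 2 + 2 * G₁ * (Kp * ℓ ^ 2) / klScale e₀ m) * 1 +
    4 * G₁ * (|2 * π / L| * (4 + 2 * A) + Kp * (ρf + 2 * ℓ) * ℓ) / klScale e₀ m * (9 * (4 * Ba * ((1 + 2 * wsi) * (2 * ℓ)))) +
    1 * 1 * (9 * (4 * Ba * ((1 + 2 * wsi) * (2 * ℓ)) ^ 2 + 8 * Ba ^ 2 * ((1 + 2 * wsi) * (2 * ℓ)) ^ 2)))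
  -- rates and the five UNIFORM inequalities
  {s₀ s₁ s₂ s₃ : ℝ} (hs₀ : 0 < s₀) (hs₁ : 0 < s₁) (hs₂ : 0 < s₂) (hs₃ : 0 < s₃)
  (hr₀ : (1 / (β * (L : ℝ) ^ 2)) ^ 2 *
      (1 * ((2 * π / β) ^ 2 * ((32 * B₂ + 144 * B₁ + 128) * (β * (L : ℝ) ^ 2) / Λ ^ 3)) +
        2 * ((2 * G₁ * |2 * π / β| * 1 / klScale e₀ m) * ((2 * π / β) * ((16 * B₁ + 16) * (β * (L : ℝ) ^ 2) / Λ ^ 2))) +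
        ((4 * G₂ + 2 * G₁) * (2 * π / β) ^ 2 * 1 / klScale e₀ m ^ 2) * (4 * (β * (L : ℝ) ^ 2) / Λ)) ≤
    (1 / (β * (L : ℝ) ^ 2)) ^ 2 * (4 * (β * (L : ℝ) ^ 2) / Λ) * (4 / (s₀ * (2 * M : ℕ))) ^ 2)
  (hr₁ : (1 / (β * (L : ℝ) ^ 2)) ^ 2 *
      (1 * ((32 * B₂ + 144 * B₁ + 128) * (β * (L : ℝ) ^ 2) / Λ ^ 3 * (K₁ * (Real.sqrt 2 * ℓ₁) + 4 * (K₂ * (Real.sqrt 2 * ℓ₁) ^ 2)) ^ 2 +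
          (16 * B₁ + 16) * (β * (L : ℝ) ^ 2) / Λ ^ 2 * (K₂ * (Real.sqrt 2 * ℓ₁) ^ 2)) +
        2 * (Ae1 * ((16 * B₁ + 16) * (β * (L : ℝ) ^ 2) / Λ ^ 2 * (K₁ * (Real.sqrt 2 * ℓ₁) + 3 * (K₂ * (Real.sqrt 2 * ℓ₁) ^ 2)))) +
        Ae2 * (4 * (β * (L : ℝ) ^ 2) / Λ)) ≤
    (1 / (β * (L : ℝ) ^ 2)) ^ 2 * (4 * (β * (L : ℝ) ^ 2) / Λ) * (4 / (s₁ * L)) ^ 2)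
  (hr₂ : (1 / (β * (L : ℝ) ^ 2)) ^ 2 *
      (1 * ((32 * B₂ + 144 * B₁ + 128) * (β * (L : ℝ) ^ 2) / Λ ^ 3 * (K₁ * (Real.sqrt 2 * ℓ) + 4 * (K₂ * (Real.sqrt 2 * ℓ) ^ 2)) ^ 2 +
          (16 * B₁ + 16) * (β * (L : ℝ) ^ 2) / Λ ^ 2 * (K₂ * (Real.sqrt 2 * ℓ) ^ 2)) +
        2 * (An1 * ((16 * B₁ + 16) * (β * (L : ℝ) ^ 2) / Λ ^ 2 * (K₁ * (Real.sqrt 2 * ℓ) + 3 * (K₂ * (Real.sqrt 2 * ℓ) ^ 2)))) +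
        An2 * (4 * (β * (L : ℝ) ^ 2) / Λ)) ≤
    (1 / (β * (L : ℝ) ^ 2)) ^ 2 * (4 * (β * (L : ℝ) ^ 2) / Λ) * (4 / (s₂ * L)) ^ 2)
  (hr₃ : (1 / (β * (L : ℝ) ^ 2)) ^ 2 *
      (1 * ((32 * B₂ + 144 * B₁ + 128) * (β * (L : ℝ) ^ 2) / Λ ^ 3 * (τt + 4 * (K₂ * (Real.sqrt 2 * ℓ) ^ 2)) ^ 2 +
          (16 * B₁ + 16) * (β * (L : ℝ) ^ 2) / Λ ^ 2 * (K₂ * (Real.sqrt 2 * ℓ) ^ 2)) +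
        2 * (Av1 * ((16 * B₁ + 16) * (β * (L : ℝ) ^ 2) / Λ ^ 2 * (τt + 3 * (K₂ * (Real.sqrt 2 * ℓ) ^ 2)))) +
        Av2 * (4 * (β * (L : ℝ) ^ 2) / Λ)) ≤
    (1 / (β * (L : ℝ) ^ 2)) ^ 2 * (4 * (β * (L : ℝ) ^ 2) / Λ) * (4 / (s₃ * L)) ^ 2)

include B hA hADt he hz hz1 hgap h3 hlo hhi hβ hρA hMm hd hd1 hd2 hB0 hB hΛ hΛΛ' hM' hK₁ hK₂ hB₁ hB₂ hNr hLz hR₀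
  hℓ₁ hℓ hρf hG₁ hG₂ hKp hwsi hτt hAe1 hAe2 hAn1 hAn2 hAv1 hAv2 hs₀ hs₁ hs₂ hs₃ hr₀ hr₁ hr₂ hr₃

/-- **The per-pair bound for every pair, with the integer frame vector constructed from the sector's Fermi point.** [folklore] -/
theorem slicePair_bgmFat_le_all (ω ω' : Fin (sectorCount (m + 1))) :
    ∑ z : TorusSite 1 (2 * M) × TorusSite 2 L,
        ‖∑ q : TorusSite 1 (2 * M) × TorusSite 2 L, (torusChar q.1 z.1 * torusChar q.2 z.2) •
          ((((1 / (β * (L : ℝ) ^ 2) : ℝ) : ℂ) ^ 2 *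
            (bgmFatMultiplier L M e₀ β (nambuXiCT L μ K) (m + 1) ω (⟨(q.1 0).val, ZMod.val_lt (q.1 0)⟩, q.2) *
              bgmFatMultiplier L M e₀ β (nambuXiCT L μ K) (m + 1) ω' (⟨(q.1 0).val, ZMod.val_lt (q.1 0)⟩, q.2) *
              sliceSymbolFnXi (β * (L : ℝ) ^ 2) 0 Λ Λ' (matsubaraFreq β M ⟨(q.1 0).val, ZMod.val_lt (q.1 0)⟩)
                (nambuXiCT L μ K q.2))))‖ ≤
      Real.sqrt (2048 * (1 / s₀ + 1) *
          (4 * ((2 * Real.sqrt 2 / (s₂ * (Nr - 1)) + 2) * (2 * Real.sqrt 2 / (s₃ * (Nr - 1)) + 2))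
            + 16 * (1 / s₁ + 1) ^ 2 / (1 + s₁ * R₀))) *
        Real.sqrt (16 * (2 * M : ℕ) * (L : ℝ) ^ 2 *
          ((klScale e₀ m * β / π + 1) *
            ((Real.sqrt 2 * L * ((klScale e₀ m + (4 + 4 * A) * ρf ^ 2) / (2 * B.rhomin - 4 * A)) / π + 2) *
              (Real.sqrt 2 * L * (2 * ρf) / π + 2)))) *
        ((1 / (β * (L : ℝ) ^ 2)) ^ 2 * (4 * (β * (L : ℝ) ^ 2) / Λ)) := by
  have hlo' : a ≤ μ - A := by linarith only [hlo, he]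
  have hhi' : μ + A ≤ b := by linarith only [hhi, he]
  set pF : Fin 2 → ℝ := klFermiPoint μ K (sectorCenter (m + 1) (ω : ℕ)) with hpF
  set eK : (Fin 2 → ℝ) → ℝ := fun p => frameLevel μ K (WithLp.toLp 2 p) with heK
  set g₀ : ℝ := fderiv ℝ eK pF (Pi.single 0 1) with hg₀
  set g₁ : ℝ := fderiv ℝ eK pF (Pi.single 1 1) with hg₁
  have hγ : 0 < 2 * B.rhomin - 4 * A := by linarith only [hρA]
  have hN0 : 0 < Real.sqrt (g₀ ^ 2 + g₁ ^ 2) := lt_of_lt_of_le hγ (gradient_floor_klFermiPoint B hA hlo' hhi' (sectorCenter (m + 1) (ω : ℕ)))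
  -- the integer frame vector
  obtain ⟨v, hv⟩ : ∃ v : Fin 2 → ℤ, v = ![round (Nr * (-g₁ / Real.sqrt (g₀ ^ 2 + g₁ ^ 2))), round (Nr * (g₀ / Real.sqrt (g₀ ^ 2 + g₁ ^ 2)))] :=
    ⟨_, rfl⟩
  have hv0 : v 0 = round (Nr * (-g₁ / Real.sqrt (g₀ ^ 2 + g₁ ^ 2))) := by rw [hv]; rfl
  have hv1 : v 1 = round (Nr * (g₀ / Real.sqrt (g₀ ^ 2 + g₁ ^ 2))) := by rw [hv]; rfl
  have hNr1 : 1 ≤ Nr := by linarith only [hNr]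
  obtain ⟨htan, hvj, hvne⟩ := tangentStep_bounds eK pF (norm_fderiv_frameBand_le hA μ pF) hN0 hNr1 v hv0 hv1 (2 * π / L)
  -- its length
  have hunit : (-g₁ / Real.sqrt (g₀ ^ 2 + g₁ ^ 2)) ^ 2 + (g₀ / Real.sqrt (g₀ ^ 2 + g₁ ^ 2)) ^ 2 = 1 := by
    have h := (frame_orthonormal hN0).2.1
    rw [neg_div]; exact h
  have hvlen : Nr - 1 ≤ Real.sqrt ((v 0 : ℝ) ^ 2 + (v 1 : ℝ) ^ 2) := by
    have h := sub_one_le_sqrt_sum_sq_round hNr (u := ![-g₁ / Real.sqrt (g₀ ^ 2 + g₁ ^ 2), g₀ / Real.sqrt (g₀ ^ 2 + g₁ ^ 2)]) hunit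
    rw [hv0, hv1]
    exact h
  exact slicePair_bgmFat_le B hA hADt he hz hz1 hgap h3 hlo hhi hβ hρA m hMm hd hd1 hd2 hB0 hB hΛ hΛΛ' hM' hK₁ hK₂ hB₁ hB₂ hNr hLz hR₀
    hℓ₁ hℓ hρf hG₁ hG₂ hKp hwsi hτt hAe1 hAe2 hAn1 hAn2 hAv1 hAv2 hs₀ hs₁ hs₂ hs₃ hr₀ hr₁ hr₂ hr₃ ω ω' v hvne hvj hvlen htan

/-- **`hrow` for the fat family**: `Σ_{Y′} ‖(S(Ft)ᵀ·C^K_{(Λ,Λ′]}·S(Ft)) Y Y′‖ ≤ 8·(9·T_max)`. [cite: BenfattoGiulianiMastropietro2006, §2.8 (2.81)] -/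
theorem rowSum_sliceCT_bgmFat_le (Y : SpaceTimeIdx L M × SectorLeg (sectorCount (m + 1))) :
    ∑ Y' : SpaceTimeIdx L M × SectorLeg (sectorCount (m + 1)),
        ‖((sectorSubMatrix L M β (bgmFatMultiplier L M e₀ β (nambuXiCT L μ K) (m + 1))).transpose *
            hubbardCovSliceCT L M β μ 0 K Λ Λ' * sectorSubMatrix L M β (bgmFatMultiplier L M e₀ β (nambuXiCT L μ K) (m + 1))) Y Y'‖ ≤
      8 * ((9 : ℕ) * (Real.sqrt (2048 * (1 / s₀ + 1) *
          (4 * ((2 * Real.sqrt 2 / (s₂ * (Nr - 1)) + 2) * (2 * Real.sqrt 2 / (s₃ * (Nr - 1)) + 2))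
            + 16 * (1 / s₁ + 1) ^ 2 / (1 + s₁ * R₀))) *
        Real.sqrt (16 * (2 * M : ℕ) * (L : ℝ) ^ 2 *
          ((klScale e₀ m * β / π + 1) *
            ((Real.sqrt 2 * L * ((klScale e₀ m + (4 + 4 * A) * ρf ^ 2) / (2 * B.rhomin - 4 * A)) / π + 2) *
              (Real.sqrt 2 * L * (2 * ρf) / π + 2)))) *
        ((1 / (β * (L : ℝ) ^ 2)) ^ 2 * (4 * (β * (L : ℝ) ^ 2) / Λ)))) := by
  have hL : (0 : ℝ) < L := Nat.cast_pos.2 (Nat.pos_of_ne_zero (NeZero.ne L))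
  refine rowSum_norm_pullback_sliceCT_le_alpha hβ.ne' μ K Λ Λ' _
    (fun ω ω' => ∃ k : FreqMomentum L M, bgmFatMultiplier L M e₀ β (nambuXiCT L μ K) (m + 1) ω k *
      bgmFatMultiplier L M e₀ β (nambuXiCT L μ K) (m + 1) ω' k ≠ 0) (by positivity)
    (fun ω ω' _ => slicePair_bgmFat_le_all B hA hADt he hz hz1 hgap h3 hlo hhi hβ hρA m hMm hd hd1 hd2 hB0 hB hΛ hΛΛ' hM' hK₁ hK₂ hB₁ hB₂
      hNr hLz hR₀ hℓ₁ hℓ hρf hG₁ hG₂ hKp hwsi hτt hAe1 hAe2 hAn1 hAn2 hAv1 hAv2 hs₀ hs₁ hs₂ hs₃ hr₀ hr₁ hr₂ hr₃ ω ω')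
    (fun ω ω' h k => ?_) (fun ω => card_overlap_bgmFat_le_nine (L := L) (M := M) (K := K) (μ := μ) (e₀ := e₀) (β := β) m ω) Y
  by_contra hk
  exact h ⟨k, hk⟩

/-- **`hcol` for the fat family**: the column twin. [cite: BenfattoGiulianiMastropietro2006, §2.8 (2.81)] -/
theorem colSum_sliceCT_bgmFat_le (Y' : SpaceTimeIdx L M × SectorLeg (sectorCount (m + 1))) :
    ∑ Y : SpaceTimeIdx L M × SectorLeg (sectorCount (m + 1)),
        ‖((sectorSubMatrix L M β (bgmFatMultiplier L M e₀ β (nambuXiCT L μ K) (m + 1))).transpose *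
            hubbardCovSliceCT L M β μ 0 K Λ Λ' * sectorSubMatrix L M β (bgmFatMultiplier L M e₀ β (nambuXiCT L μ K) (m + 1))) Y Y'‖ ≤
      8 * ((9 : ℕ) * (Real.sqrt (2048 * (1 / s₀ + 1) *
          (4 * ((2 * Real.sqrt 2 / (s₂ * (Nr - 1)) + 2) * (2 * Real.sqrt 2 / (s₃ * (Nr - 1)) + 2))
            + 16 * (1 / s₁ + 1) ^ 2 / (1 + s₁ * R₀))) *
        Real.sqrt (16 * (2 * M : ℕ) * (L : ℝ) ^ 2 *
          ((klScale e₀ m * β / π + 1) *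
            ((Real.sqrt 2 * L * ((klScale e₀ m + (4 + 4 * A) * ρf ^ 2) / (2 * B.rhomin - 4 * A)) / π + 2) *
              (Real.sqrt 2 * L * (2 * ρf) / π + 2)))) *
        ((1 / (β * (L : ℝ) ^ 2)) ^ 2 * (4 * (β * (L : ℝ) ^ 2) / Λ)))) := by
  have hL : (0 : ℝ) < L := Nat.cast_pos.2 (Nat.pos_of_ne_zero (NeZero.ne L))
  refine colSum_norm_pullback_sliceCT_le_alpha hβ.ne' μ K Λ Λ' _
    (fun ω ω' => ∃ k : FreqMomentum L M, bgmFatMultiplier L M e₀ β (nambuXiCT L μ K) (m + 1) ω k *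
      bgmFatMultiplier L M e₀ β (nambuXiCT L μ K) (m + 1) ω' k ≠ 0) (by positivity)
    (fun ω ω' _ => slicePair_bgmFat_le_all B hA hADt he hz hz1 hgap h3 hlo hhi hβ hρA m hMm hd hd1 hd2 hB0 hB hΛ hΛΛ' hM' hK₁ hK₂ hB₁ hB₂
      hNr hLz hR₀ hℓ₁ hℓ hρf hG₁ hG₂ hKp hwsi hτt hAe1 hAe2 hAn1 hAn2 hAv1 hAv2 hs₀ hs₁ hs₂ hs₃ hr₀ hr₁ hr₂ hr₃ ω ω')
    (fun ω ω' h k => ?_) (fun ω' => card_overlap_bgmFat_le_nine' (L := L) (M := M) (K := K) (μ := μ) (e₀ := e₀) (β := β) m ω') Y'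
  by_contra hk
  exact h ⟨k, hk⟩

end Rows

end Summit.HubbardSuperconductivity.HubbardSuperconductivity.Theorems.TorusFourierL2

end
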